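import Literature.NumberTheory.ComplexMultiplication.EllipticUnits.ImaginaryQuadraticMainConjectureClassGroupRowCokernelLocal
import Literature.NumberTheory.ComplexMultiplication.EllipticUnits.ImaginaryQuadraticMainConjectureClassGroupRowRange
import Summits.BirchSwinnertonDyer.BirchSwinnertonDyer.Theorems.PrintCf2RubinValueTwoJLKDescentPseudoNull
import HarnessLib

/-!
# (α3) KERNEL DESCENT — ROW 1, the COKERNEL of the class-group row `Φ : C.X →ₗ[Λ₂] I.H` (`hfcoker`) from LOCAL ANNIHILATION DATA:
# the height-two choice of annihilators in `Λ₂ = ℤ_p⟦T₂⟧⟦T₁⟧` and the assembly of the `hfcoker` binder of the descent lemma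

Cell `bsd-print-cf2`, width seat `bsd-line-cf2c-w8` g9 (prover-bsd-line-cf2c-w8-g9-0), lane (α3) ROW 1 (Poitou–Tate) of the planner brief
`Cruxes/MainConjClauseAtSplitTwoQuad/JLK-CARRIER-2-BRIEF-plan-g20.md` for the DECIDING research child `PrintCf2RubinValueTwo.MainConjClauseAtSplitTwoQuadDA`
(stmt-BirchSwinnertonDyer-24721), stub `stub_classGroupHalf`; `--supports` it `--as helper`, Theses-free.  Sequel of the Literature files
`…/EllipticUnits/ImaginaryQuadraticMainConjectureClassGroupRow{Glue,Range,CokernelLocal}.lean` (this seat): there `hfcoker` — «at every prime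
`𝔭` of height `≤ 1` with `p ∉ 𝔭`, every `y : I.H` has `r • y ∈ range Φ` for some `r ∉ 𝔭`» — was reduced to per-place ANNIHILATORS killing the
localisations of the level components (`exists_smul_forall_proj_mem_layerShaRestricted`), and two SUPPLIERS were given: a scalar `m = p^e` killing the
local groups `H²(φ_v⁻¹V̄_n, (μ_{p^k} ⊗ θ′)|)`, and `p^e · ((1+T_i) − u_i)` when `η_i = res_v(δ_i)·h_i` (`h_i ∈ Gal(K̄/K̃_∞)`) and the LOCAL operator
`p^e · (conj_{δ_i} − u_i)` kills those groups.  THIS FILE makes the CHOICE `r ∉ 𝔭`: at a place of the second kind the two candidates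
`(1+T₁) − u₁ = T₁ + (1 − u₁)` (unit coefficient of `T₁`) and `(1+T₂) − u₂ = C(T₂ + (1 − u₂))` (a non-zero constant of `ℤ_p⟦T₂⟧`) are not both in a
prime of height `≤ 1` (cell theorem `JLKDescent.C_notMem_or_notMem_of_height_le_one`, part I of the descent), and `p^e ∉ 𝔭` as `p ∉ 𝔭`.

* `exists_notMem_forall_proj_mem_layerShaRestricted` — **the local plug (π4b)** from the displayed local annihilation data, place by place
  (EITHER `p^e` kills the local `H²`'s at `v`, OR both `η₁, η₂` decompose at `v` with conj-type local data);
* `classGroupRow_hfcoker` — **the `hfcoker` binder of `JLKDescent.exists_charIdeal_mul_pow_eq_of_zetaSkeleton` for `f := Φ`**, from the same data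
  (via `classGroupRow_hfcoker_of_local`, i.e. `classGroupRow_mem_range_iff` = JLK Lemma 5.8 with `hglue` discharged).

What is NOT here (named, displayed as the hypotheses `hloc`): the local class field theory fact that `Gal(K̄_v/K_v)` acts TRIVIALLY on
`H²(Gal(K̄_v/K̃_{n,w}), μ_{p^k}) = Br(K̃_{n,w})[p^k]` (Galois-invariance of the layer invariant maps; equivalently injectivity of the corestriction on
`H²(·, μ_n)` for subgroups of `p`-power index — the tree's `eq_zero_of_cor_two_mu_eq_zero` covers index prime to `p`, `Prop121vii.invLevel_corMu` the
field dialect), which turns `conj_δ` into multiplication by `θ′(δ)` on `H²(·, μ_{p^k} ⊗ θ′)` and bounds the group by `2` where `θ′ ∋ −1`.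
HONEST FRAMING: bookkeeping over the Literature sockets; no summit statement is proved by this seat; BSD is not proved by any of this.

References: J. Johnson-Leung, G. Kings, J. reine angew. Math. 653 (2011) §5.4 Lemma 5.8 [JohnsonLeungKings2011]; J. S. Milne, *Arithmetic Duality
Theorems* (2006) I §4, I Cor. 2.3 [MilneADT2006]; Neukirch–Schmidt–Wingberg (2008) V §1 (5.1.4)–(5.1.6) [NeukirchSchmidtWingberg2008].
-/

noncomputable section

set_option linter.dupNamespace false -- D-0017: single-problem summit, `…BirchSwinnertonDyer.BirchSwinnertonDyer…` repeats a namespace by design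
set_option autoImplicit false

open scoped NumberField
open CategoryTheory Function Field IsDedekindDomain NumberField
open Literature.NumberTheory.GaloisRepresentations
open Literature.NumberTheory.GaloisRepresentations.DiscreteGaloisModule
open Literature.NumberTheory.EllipticCurves
open Literature.NumberTheory.GaloisCohomology.ShaLayer (locHom layerLocalization layerConj layerShaRestricted)
open Literature.NumberTheory.ComplexMultiplication.EllipticUnits.JohnsonLeungKings2011 (IwasawaCohomologyData pairLayerSubgroup muTwist suppPF zmodTwist)
open Literature.NumberTheory.ComplexMultiplication.EllipticUnits (ClassGroupDualData₂)
open Literature.NumberTheory.GaloisCohomology (poitouTate_shaRestricted_tateDual_natural_at)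
open Literature.NumberTheory.EllipticCurves.KellerYin2024 (unitChar charModule)
open Literature.NumberTheory.ComplexMultiplication.EllipticUnits.JohnsonLeungKings2011.ClassGroupRow

namespace Summit.BirchSwinnertonDyer.BirchSwinnertonDyer.Theorems.PrintCf2.JLKDescent

variable {K : Type} [Field K] [NumberField K] {p : ℕ} [Fact p.Prime]
  {κ₁ κ₂ : ZpExtension K p} {η₁ η₂ : absoluteGaloisGroup K} {θ' : absoluteGaloisGroup K →ₜ* ℤ_[p]ˣ} {𝔣 : Ideal (𝓞 K)}

/-! ## §1. The two candidates `(1+T₁) − u₁`, `(1+T₂) − u₂` are not both in a prime of height `≤ 1` -/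

/-- `(1 + T₂) − u = C (T₂ + C (1 − u))` in `Λ₂ = ℤ_p⟦T₂⟧⟦T₁⟧` (`T₂ = C X` the inner variable). [folklore] -/
theorem one_add_CX_sub_intCast_eq (u : ℤ) :
    (1 + (PowerSeries.C (PowerSeries.X : IwasawaAlgebra p) : IwasawaAlgebra₂ p) - (u : IwasawaAlgebra₂ p)) =
      PowerSeries.C (PowerSeries.X + PowerSeries.C (1 - (u : ℤ_[p])) : IwasawaAlgebra p) := by
  rw [map_add, map_sub, map_one, map_intCast, map_sub, map_one, map_intCast]
  ring

/-- `T₂ + C (1 − u) ≠ 0` in `ℤ_p⟦T₂⟧` (its coefficient of `T₂` is `1`). [folklore] -/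
theorem X_add_C_ne_zero (c : ℤ_[p]) : (PowerSeries.X + PowerSeries.C c : IwasawaAlgebra p) ≠ 0 := by
  intro h
  have h1 := congrArg (PowerSeries.coeff 1) h
  rw [map_add, PowerSeries.coeff_one_X, PowerSeries.coeff_C, if_neg one_ne_zero, add_zero, map_zero] at h1
  exact one_ne_zero h1

/-- The coefficient of `T₁` in `(1 + T₁) − u` is `1`. [folklore] -/
theorem coeff_one_one_add_X_sub_intCast (u : ℤ) :
    PowerSeries.coeff 1 (1 + PowerSeries.X - (u : IwasawaAlgebra₂ p) : IwasawaAlgebra₂ p) = 1 := by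
  rw [map_sub, map_add, PowerSeries.coeff_one, if_neg one_ne_zero, PowerSeries.coeff_one_X, zero_add,
    ← map_intCast (PowerSeries.C (R := IwasawaAlgebra p)) u, PowerSeries.coeff_C, if_neg one_ne_zero, sub_zero]

/-- **At a prime `𝔭 ⊂ Λ₂` of height `≤ 1`, one of `(1+T₁) − u₁`, `(1+T₂) − u₂` lies outside `𝔭`** (a prime containing both contains a
non-zero constant of `ℤ_p⟦T₂⟧` and a series with a unit coefficient, so has height `≥ 2`: part I of the descent). [cite: NeukirchSchmidtWingberg2008, Ch. V §1, (5.1.4) Remark 1] -/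
theorem one_add_X_sub_notMem_or (𝔭 : PrimeSpectrum (IwasawaAlgebra₂ p)) (h𝔭 : 𝔭.asIdeal.height ≤ 1) (u₁ u₂ : ℤ) :
    (1 + PowerSeries.X - (u₁ : IwasawaAlgebra₂ p) : IwasawaAlgebra₂ p) ∉ 𝔭.asIdeal ∨
      (1 + (PowerSeries.C (PowerSeries.X : IwasawaAlgebra p) : IwasawaAlgebra₂ p) - (u₂ : IwasawaAlgebra₂ p)) ∉ 𝔭.asIdeal := by
  rcases C_notMem_or_notMem_of_height_le_one 𝔭 h𝔭 (X_add_C_ne_zero (p := p) (1 - (u₂ : ℤ_[p])))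
    (b := (1 + PowerSeries.X - (u₁ : IwasawaAlgebra₂ p) : IwasawaAlgebra₂ p)) (n := 1)
    (by rw [coeff_one_one_add_X_sub_intCast]; exact isUnit_one) with h | h
  · right; rwa [one_add_CX_sub_intCast_eq]
  · left; exact h

/-- Products of elements outside a prime stay outside. [folklore] -/
theorem mul_notMem_of_notMem (𝔭 : PrimeSpectrum (IwasawaAlgebra₂ p)) {a b : IwasawaAlgebra₂ p}
    (ha : a ∉ 𝔭.asIdeal) (hb : b ∉ 𝔭.asIdeal) : a * b ∉ 𝔭.asIdeal := fun h =>
  (𝔭.isPrime.mem_or_mem h).elim ha hb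

/-- `p^e ∉ 𝔭` (read in `Λ₂`) when `p ∉ 𝔭`. [folklore] -/
theorem natCast_pow_notMem (𝔭 : PrimeSpectrum (IwasawaAlgebra₂ p)) (hp : ((p : ℕ) : IwasawaAlgebra₂ p) ∉ 𝔭.asIdeal) (e : ℕ) :
    ((p ^ e : ℕ) : IwasawaAlgebra₂ p) ∉ 𝔭.asIdeal := by
  rw [Nat.cast_pow]
  exact fun h => hp (𝔭.isPrime.mem_of_pow_mem e h)

/-! ## §2. The local plug (π4b) and `hfcoker` from local annihilation data -/

/-- **THE LOCAL PLUG (π4b) OF ROW 1 from LOCAL ANNIHILATION DATA.**  `K` totally complex, `supp(p𝔣)` finite; `I` a pinned carrier of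
`H²(𝒪_K[1/p𝔣], Λ(θ′)(1))` at the pair `(η₁, η₂)`; `e : ℕ`.  Suppose that at every `v ∈ supp(p𝔣)` EITHER `p^e` kills the local groups
`H²(φ_v⁻¹V̄_n, (μ_{p^k} ⊗ θ′)|)` for all `n, k` (meant: `θ′ = −1` somewhere on every `Gal(K̄_v/K̃_{n,w})`), OR both pins decompose at `v`,
`η_i = res_v(δ_i) · h_i` with `h_i ∈ Gal(K̄/K̃_∞)`, and the local operators `p^e · (conj_{δ_i} − u_i)` (`u_i : ℤ`, meant `θ′(δ_i) = ±1`) kill those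
groups.  Then for every prime `𝔭 ⊂ Λ₂` of height `≤ 1` with `p ∉ 𝔭` and every `y : I.H` there is `r ∉ 𝔭` with ALL `proj_{n,k}(r • y) ∈ Ш²_S`.
[cite: JohnsonLeungKings2011, §5.4 Lemma 5.8 and its proof] [cite: NeukirchSchmidtWingberg2008, Ch. V §1, (5.1.4)–(5.1.6)] -/
theorem exists_notMem_forall_proj_mem_layerShaRestricted (I : IwasawaCohomologyData p κ₁ κ₂ η₁ η₂ θ' 𝔣 2)
    (hcx : ∀ w : InfinitePlace K, w.IsComplex) (hfin : (suppPF p 𝔣).Finite) (e : ℕ)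
    (hplaces : ∀ v ∈ suppPF p 𝔣,
      (∀ (n k : ℕ) (c : continuousCohomology 2 (subgroupRep
        (TopRep.res (locHom (S := suppPF p 𝔣) v : absoluteGaloisGroup (v.adicCompletion K) →* GaloisGroupUnramifiedOutside K (suppPF p 𝔣))
          ((muTwist p θ' k).quotientInvariants (ramificationSubgroup K (suppPF p 𝔣))).toTopRep)
        (((pairLayerSubgroup κ₁ κ₂ n).map (toUnramifiedQuot K (suppPF p 𝔣))).comap
          (locHom (S := suppPF p 𝔣) v : absoluteGaloisGroup (v.adicCompletion K) →* GaloisGroupUnramifiedOutside K (suppPF p 𝔣))))),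
        p ^ e • c = 0) ∨
      ((∃ (δ : absoluteGaloisGroup (v.adicCompletion K)) (h : absoluteGaloisGroup K) (u : ℤ),
          h ∈ ZpExtension.pairKer κ₁ κ₂ ∧ η₁ = absGaloisRestrict K (v.adicCompletion K) δ * h ∧
          ∀ (n k : ℕ) (c : continuousCohomology 2 (subgroupRep
            (TopRep.res (locHom (S := suppPF p 𝔣) v : absoluteGaloisGroup (v.adicCompletion K) →* GaloisGroupUnramifiedOutside K (suppPF p 𝔣))
              ((muTwist p θ' k).quotientInvariants (ramificationSubgroup K (suppPF p 𝔣))).toTopRep)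
            (((pairLayerSubgroup κ₁ κ₂ n).map (toUnramifiedQuot K (suppPF p 𝔣))).comap
              (locHom (S := suppPF p 𝔣) v : absoluteGaloisGroup (v.adicCompletion K) →* GaloisGroupUnramifiedOutside K (suppPF p 𝔣))))),
            p ^ e • ((conjMap (TopRep.res (locHom (S := suppPF p 𝔣) v : absoluteGaloisGroup (v.adicCompletion K) →*
                GaloisGroupUnramifiedOutside K (suppPF p 𝔣)) ((muTwist p θ' k).quotientInvariants (ramificationSubgroup K (suppPF p 𝔣))).toTopRep)
              (((pairLayerSubgroup κ₁ κ₂ n).map (toUnramifiedQuot K (suppPF p 𝔣))).comap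
                (locHom (S := suppPF p 𝔣) v : absoluteGaloisGroup (v.adicCompletion K) →* GaloisGroupUnramifiedOutside K (suppPF p 𝔣))) δ 2).hom c -
              u • c) = 0) ∧
        (∃ (δ : absoluteGaloisGroup (v.adicCompletion K)) (h : absoluteGaloisGroup K) (u : ℤ),
          h ∈ ZpExtension.pairKer κ₁ κ₂ ∧ η₂ = absGaloisRestrict K (v.adicCompletion K) δ * h ∧
          ∀ (n k : ℕ) (c : continuousCohomology 2 (subgroupRep
            (TopRep.res (locHom (S := suppPF p 𝔣) v : absoluteGaloisGroup (v.adicCompletion K) →* GaloisGroupUnramifiedOutside K (suppPF p 𝔣))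
              ((muTwist p θ' k).quotientInvariants (ramificationSubgroup K (suppPF p 𝔣))).toTopRep)
            (((pairLayerSubgroup κ₁ κ₂ n).map (toUnramifiedQuot K (suppPF p 𝔣))).comap
              (locHom (S := suppPF p 𝔣) v : absoluteGaloisGroup (v.adicCompletion K) →* GaloisGroupUnramifiedOutside K (suppPF p 𝔣))))),
            p ^ e • ((conjMap (TopRep.res (locHom (S := suppPF p 𝔣) v : absoluteGaloisGroup (v.adicCompletion K) →*
                GaloisGroupUnramifiedOutside K (suppPF p 𝔣)) ((muTwist p θ' k).quotientInvariants (ramificationSubgroup K (suppPF p 𝔣))).toTopRep)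
              (((pairLayerSubgroup κ₁ κ₂ n).map (toUnramifiedQuot K (suppPF p 𝔣))).comap
                (locHom (S := suppPF p 𝔣) v : absoluteGaloisGroup (v.adicCompletion K) →* GaloisGroupUnramifiedOutside K (suppPF p 𝔣))) δ 2).hom c -
              u • c) = 0)))
    (𝔭 : PrimeSpectrum (IwasawaAlgebra₂ p)) (h𝔭 : 𝔭.asIdeal.height ≤ 1) (hp : ((p : ℕ) : IwasawaAlgebra₂ p) ∉ 𝔭.asIdeal) (y : I.H) :
    ∃ r : IwasawaAlgebra₂ p, r ∉ 𝔭.asIdeal ∧ ∀ n k : ℕ,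
      I.proj n k (r • y) ∈ layerShaRestricted (suppPF p 𝔣) (muTwist p θ' k) (pairLayerSubgroup κ₁ κ₂ n) 2 := by
  refine exists_smul_forall_proj_mem_layerShaRestricted I hcx hfin (fun r => r ∉ 𝔭.asIdeal)
    (fun h1 => 𝔭.isPrime.ne_top ((Ideal.eq_top_iff_one _).mpr h1)) (fun a b ha hb => mul_notMem_of_notMem 𝔭 ha hb)
    (fun v => {a | ∀ (y : I.H) (n k : ℕ) (σ : GaloisGroupUnramifiedOutside K (suppPF p 𝔣)),
      layerLocalization (suppPF p 𝔣) (muTwist p θ' k) (pairLayerSubgroup κ₁ κ₂ n) (Sum.inr v) 2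
        (layerConj (suppPF p 𝔣) (muTwist p θ' k) (pairLayerSubgroup κ₁ κ₂ n) σ 2 (I.proj n k (a • y))) = 0})
    (fun v hv => ?_) (fun v _ a ha y n k σ => ha y n k σ) y
  refine (hplaces v hv).elim (fun hkill => ⟨((p ^ e : ℕ) : IwasawaAlgebra₂ p), fun y n k σ =>
      layerLocalization_layerConj_proj_natCast_smul_eq_zero I v (p ^ e) hkill y n k σ, natCast_pow_notMem 𝔭 hp e⟩) ?_
  intro hconj
  exact hconj.1.elim fun δ₁ H => H.elim fun h₁ H => H.elim fun u₁ H₁ =>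
    hconj.2.elim fun δ₂ H' => H'.elim fun h₂ H' => H'.elim fun u₂ H₂ =>
      (one_add_X_sub_notMem_or 𝔭 h𝔭 u₁ u₂).elim
        (fun h => ⟨((p ^ e : ℕ) : IwasawaAlgebra₂ p) * (1 + PowerSeries.X - (u₁ : IwasawaAlgebra₂ p)), fun y n k σ =>
          layerLocalization_layerConj_proj_T₁_smul_eq_zero I v (p ^ e) u₁ δ₁ h₁ H₁.1 H₁.2.1 H₁.2.2 y n k σ,
          mul_notMem_of_notMem 𝔭 (natCast_pow_notMem 𝔭 hp e) h⟩)
        (fun h => ⟨((p ^ e : ℕ) : IwasawaAlgebra₂ p) *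
            (1 + (PowerSeries.C (PowerSeries.X : IwasawaAlgebra p) : IwasawaAlgebra₂ p) - (u₂ : IwasawaAlgebra₂ p)), fun y n k σ =>
          layerLocalization_layerConj_proj_T₂_smul_eq_zero I v (p ^ e) u₂ δ₂ h₂ H₂.1 H₂.2.1 H₂.2.2 y n k σ,
          mul_notMem_of_notMem 𝔭 (natCast_pow_notMem 𝔭 hp e) h⟩)

/-- **THE `hfcoker` BINDER OF ROW 1 from local annihilation data.**  For the class-group row `Φ : C.X →ₗ[Λ₂] I.H` of JLK Lemma 5.8
(`ClassGroupRow.exists_linearMap_classGroupRow`, characterised by `hΦ`), `θ = ±1` on `Gal(K̄/K̃_∞)` (`hθH`), `K` totally complex and the local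
annihilation data of `exists_notMem_forall_proj_mem_layerShaRestricted`: at every prime `𝔭 ⊂ Λ₂` of height `≤ 1` with `p ∉ 𝔭`, every
`y : I.H` has `r • y ∈ range Φ` for some `r ∉ 𝔭` — the hypothesis `hfcoker` of `exists_charIdeal_mul_pow_eq_of_zetaSkeleton` for `f := Φ`.
[cite: JohnsonLeungKings2011, §5.4 Lemma 5.8 and its proof] [cite: MilneADT2006, I Thm. 4.10 (a), I §4 p. 65] -/
theorem classGroupRow_hfcoker {θ : FramedGaloisRep K (padicCoeffIntegers (∅ : Set (PadicAlgCl p))) 1}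
    [hFin : ∀ n : ℕ, Fintype (absoluteGaloisGroup K ⧸ pairLayerSubgroup κ₁ κ₂ n)]
    {h : poitouTate_shaRestricted_tateDual_natural_at K (suppPF p 𝔣)}
    {hθ : ∀ σ : absoluteGaloisGroup K, ((θ' σ : ℤ_[p]ˣ) : ℤ_[p]) * ((unitChar θ σ : ℤ_[p]ˣ) : ℤ_[p]) = 1}
    {hV : ∀ n : ℕ, ramificationSubgroup K (suppPF p 𝔣) ≤ pairLayerSubgroup κ₁ κ₂ n}
    {hμ : ∀ k : ℕ, ramificationSubgroup K (suppPF p 𝔣) ≤ ContinuousRep.ker (muTwist p θ' k)}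
    {hZ : ∀ k : ℕ, ramificationSubgroup K (suppPF p 𝔣) ≤ ContinuousRep.ker (zmodTwist p (unitChar θ) k)}
    {C : ClassGroupDualData₂ κ₁ κ₂ θ η₁ η₂} (I : IwasawaCohomologyData p κ₁ κ₂ η₁ η₂ θ' 𝔣 2) {Φ : C.X →ₗ[IwasawaAlgebra₂ p] I.H}
    (hΦ : ∀ (n k : ℕ) (x : C.X),
      ∃ hx : I.proj n k (Φ x) ∈ layerShaRestricted (suppPF p 𝔣) (muTwist p θ' k) (pairLayerSubgroup κ₁ κ₂ n) 2,
        ∀ z : shaOne p κ₁ κ₂ θ 𝔣 n k,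
          pair p κ₁ κ₂ θ θ' 𝔣 h hθ hV hμ hZ n k ⟨I.proj n k (Φ x), hx⟩ z = C.toDual x (iota p κ₁ κ₂ θ 𝔣 n k z))
    (hθH : ∀ g ∈ ZpExtension.pairKer κ₁ κ₂, unitChar θ g = 1 ∨ unitChar θ g = -1)
    (hcx : ∀ w : InfinitePlace K, w.IsComplex) (hfin : (suppPF p 𝔣).Finite) (e : ℕ)
    (hplaces : ∀ v ∈ suppPF p 𝔣,
      (∀ (n k : ℕ) (c : continuousCohomology 2 (subgroupRep
        (TopRep.res (locHom (S := suppPF p 𝔣) v : absoluteGaloisGroup (v.adicCompletion K) →* GaloisGroupUnramifiedOutside K (suppPF p 𝔣))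
          ((muTwist p θ' k).quotientInvariants (ramificationSubgroup K (suppPF p 𝔣))).toTopRep)
        (((pairLayerSubgroup κ₁ κ₂ n).map (toUnramifiedQuot K (suppPF p 𝔣))).comap
          (locHom (S := suppPF p 𝔣) v : absoluteGaloisGroup (v.adicCompletion K) →* GaloisGroupUnramifiedOutside K (suppPF p 𝔣))))),
        p ^ e • c = 0) ∨
      ((∃ (δ : absoluteGaloisGroup (v.adicCompletion K)) (h : absoluteGaloisGroup K) (u : ℤ),
          h ∈ ZpExtension.pairKer κ₁ κ₂ ∧ η₁ = absGaloisRestrict K (v.adicCompletion K) δ * h ∧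
          ∀ (n k : ℕ) (c : continuousCohomology 2 (subgroupRep
            (TopRep.res (locHom (S := suppPF p 𝔣) v : absoluteGaloisGroup (v.adicCompletion K) →* GaloisGroupUnramifiedOutside K (suppPF p 𝔣))
              ((muTwist p θ' k).quotientInvariants (ramificationSubgroup K (suppPF p 𝔣))).toTopRep)
            (((pairLayerSubgroup κ₁ κ₂ n).map (toUnramifiedQuot K (suppPF p 𝔣))).comap
              (locHom (S := suppPF p 𝔣) v : absoluteGaloisGroup (v.adicCompletion K) →* GaloisGroupUnramifiedOutside K (suppPF p 𝔣))))),
            p ^ e • ((conjMap (TopRep.res (locHom (S := suppPF p 𝔣) v : absoluteGaloisGroup (v.adicCompletion K) →*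
                GaloisGroupUnramifiedOutside K (suppPF p 𝔣)) ((muTwist p θ' k).quotientInvariants (ramificationSubgroup K (suppPF p 𝔣))).toTopRep)
              (((pairLayerSubgroup κ₁ κ₂ n).map (toUnramifiedQuot K (suppPF p 𝔣))).comap
                (locHom (S := suppPF p 𝔣) v : absoluteGaloisGroup (v.adicCompletion K) →* GaloisGroupUnramifiedOutside K (suppPF p 𝔣))) δ 2).hom c -
              u • c) = 0) ∧
        (∃ (δ : absoluteGaloisGroup (v.adicCompletion K)) (h : absoluteGaloisGroup K) (u : ℤ),
          h ∈ ZpExtension.pairKer κ₁ κ₂ ∧ η₂ = absGaloisRestrict K (v.adicCompletion K) δ * h ∧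
          ∀ (n k : ℕ) (c : continuousCohomology 2 (subgroupRep
            (TopRep.res (locHom (S := suppPF p 𝔣) v : absoluteGaloisGroup (v.adicCompletion K) →* GaloisGroupUnramifiedOutside K (suppPF p 𝔣))
              ((muTwist p θ' k).quotientInvariants (ramificationSubgroup K (suppPF p 𝔣))).toTopRep)
            (((pairLayerSubgroup κ₁ κ₂ n).map (toUnramifiedQuot K (suppPF p 𝔣))).comap
              (locHom (S := suppPF p 𝔣) v : absoluteGaloisGroup (v.adicCompletion K) →* GaloisGroupUnramifiedOutside K (suppPF p 𝔣))))),
            p ^ e • ((conjMap (TopRep.res (locHom (S := suppPF p 𝔣) v : absoluteGaloisGroup (v.adicCompletion K) →*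
                GaloisGroupUnramifiedOutside K (suppPF p 𝔣)) ((muTwist p θ' k).quotientInvariants (ramificationSubgroup K (suppPF p 𝔣))).toTopRep)
              (((pairLayerSubgroup κ₁ κ₂ n).map (toUnramifiedQuot K (suppPF p 𝔣))).comap
                (locHom (S := suppPF p 𝔣) v : absoluteGaloisGroup (v.adicCompletion K) →* GaloisGroupUnramifiedOutside K (suppPF p 𝔣))) δ 2).hom c -
              u • c) = 0))) :
    ∀ 𝔭 : PrimeSpectrum (IwasawaAlgebra₂ p), 𝔭.asIdeal.height ≤ 1 → ((p : ℕ) : IwasawaAlgebra₂ p) ∉ 𝔭.asIdeal →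
      ∀ y : I.H, ∃ r ∉ 𝔭.asIdeal, r • y ∈ LinearMap.range Φ :=
  fun 𝔭 h𝔭 hp y =>
    classGroupRow_hfcoker_of_local hΦ hθH (fun r => r ∉ 𝔭.asIdeal) y
      (exists_notMem_forall_proj_mem_layerShaRestricted I hcx hfin e hplaces 𝔭 h𝔭 hp y)

end Summit.BirchSwinnertonDyer.BirchSwinnertonDyer.Theorems.PrintCf2.JLKDescent

end
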